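import Summits.ResolutionOfSingularities.ResolutionOfSingularities.Theorems.RadicialJungCleanModelsNSPreChain
import Summits.ResolutionOfSingularities.ResolutionOfSingularities.Theorems.RadicialJungCleanModelsNSChainTransport
import Summits.ResolutionOfSingularities.ResolutionOfSingularities.Theorems.RadicialJungCleanModelsNSPostChain
import HarnessLib

/-!
# `hMono_4` at every zero-dimensional valuation from `hMono_4` at RANK-ONE valuations, modulo F-02 + F-32 and the residue-side chains (the ASSEMBLY)

Route `RadicialJung`, crux `CleanModels` (stmt-ResolutionOfSingularities-15917), registered skeleton `Cruxes/CleanModels/Lines/Sketch.lean`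
rev 35 (sha16 de44649d8f729c3b), stub 7 `stub_cleanModelsDimGEFour`.  Explicit-unit seat `decomp-res-hand-2` g5 (structural hand); memo
`Cruxes/CleanModels/Lines/Sketch-memo-hand2-g5-stubs-5-7.md` §3, spec `Lines/Sketch_hand2_g5_NS32_assembly_spec.lean` rev 3 (`ResidueChains`).
OURS; structural bookkeeping, counted 0; nothing here proves resolution of singularities in characteristic `p`.

`localMonomialization_four_of_rankOne_of_residueChains` — the repaired Novacoski–Spivakovsky 2012 Thm. 1.2 in transcendence degree `4`:
local uniformization WITH MONOMIALIZATION (`hMono_4`, regular start, zero-dimensional valuations) holds at EVERY zero-dimensional valuation ring as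
soon as it holds at the RANK-ONE ones, given F-02 (`CossartPiltant2019`), F-32 (CJS Cor. 1.5 in the `hEmb` shape) and the residue-side chains of
coordinate blowing ups (`ResidueChains` of the spec, stated inline as the hypothesis `hChains`; = CJS Thm. 1.4 localised along the residue valuation,
to be derived from the tree's `CossartJannsenSaito2020Embedded`).  Proof = ✓ `preChain_normalForm` (S1–S4) → `hChains` → ✓ `chainTransport_of_isRsopPart`
(S5) → regrouping → ✓ `absorb_of_residue_monomial` (S6).
[cite: NovacoskiSpivakovsky2014, Thm. 1.2 and §3.2] [cite: CossartPiltant2019, Thm. 1.1] [cite: CossartJannsenSaito2020, Thm. 1.4 and Cor. 1.5]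
-/

noncomputable section

set_option linter.dupNamespace false -- mandated namespace of this single-conjunct summit

open IsLocalRing AlgebraicGeometry CategoryTheory
open Literature.AlgebraicGeometry.Resolution Literature.AlgebraicGeometry.Motives

namespace Summit.ResolutionOfSingularities.ResolutionOfSingularities.Theorems.RadicialJung.CleanModels

/-- Matching two finite families of the same size through injective maps: if every element of `T` is hit from `Y`, every element of `Y` hits
`T`. [folklore] -/
theorem exists_mem_eq_of_card_eq {α β γ : Type*} [DecidableEq β] (Y : Finset α) (T : Finset γ) (f : α → β) (g : γ → β)
    (hf : ∀ a ∈ Y, ∀ a' ∈ Y, f a = f a' → a = a') (hg : Function.Injective g)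
    (hT : ∀ c ∈ T, ∃ a ∈ Y, f a = g c) (hcard : T.card = Y.card) :
    ∀ a ∈ Y, ∃ c ∈ T, g c = f a := by
  intro a ha
  have himg : T.image g ⊆ Y.image f := by
    intro x hx
    obtain ⟨c, hc, rfl⟩ := Finset.mem_image.mp hx
    obtain ⟨a', ha', h⟩ := hT c hc
    exact Finset.mem_image.mpr ⟨a', ha', h⟩
  have heq : T.image g = Y.image f :=
    Finset.eq_of_subset_of_card_le himg (by
      rw [Finset.card_image_of_injective _ hg, Finset.card_image_of_injOn hf, hcard])
  have : f a ∈ T.image g := by rw [heq]; exact Finset.mem_image.mpr ⟨a, ha, rfl⟩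
  obtain ⟨c, hc, h⟩ := Finset.mem_image.mp this
  exact ⟨c, hc, h⟩

/-- Unit-times-monomial forms are closed under products. [folklore] -/
theorem isMonomialForm_prod {F : Type} [Field F] (Ō : ValuationSubring F) (S : Subring F) {t : ℕ} (xb : Fin t → F)
    {ι : Type*} (s : Finset ι) (w : ι → F)
    (hw : ∀ i ∈ s, ∃ (ub : F) (δ : Fin t → ℕ), ub ∈ S ∧ Ō.valuation ub = 1 ∧ w i = ub * ∏ l, xb l ^ δ l) :
    ∃ (ub : F) (δ : Fin t → ℕ), ub ∈ S ∧ Ō.valuation ub = 1 ∧ (∏ i ∈ s, w i) = ub * ∏ l, xb l ^ δ l := by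
  classical
  induction s using Finset.induction_on with
  | empty => exact ⟨1, 0, S.one_mem, map_one _, by simp⟩
  | insert i s hi ih =>
    obtain ⟨u₁, δ₁, hu₁S, hu₁, h₁⟩ := hw i (Finset.mem_insert_self i s)
    obtain ⟨u₂, δ₂, hu₂S, hu₂, h₂⟩ := ih (fun j hj => hw j (Finset.mem_insert_of_mem hj))
    refine ⟨u₁ * u₂, δ₁ + δ₂, S.mul_mem hu₁S hu₂S, by rw [map_mul, hu₁, hu₂, one_mul], ?_⟩
    rw [Finset.prod_insert hi, h₁, h₂]
    simp only [Pi.add_apply, pow_add, Finset.prod_mul_distrib]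
    ring

/-- **The assembly.** See the module docstring; `hChains` is `ResidueChains` of the g5 spec (rev 3), inlined.
[cite: NovacoskiSpivakovsky2014, Thm. 1.2 and §3.2] [cite: CossartPiltant2019, Thm. 1.1] [cite: CossartJannsenSaito2020, Thm. 1.4 and Cor. 1.5] -/
theorem localMonomialization_four_of_rankOne_of_residueChains (hCP : CossartPiltant2019.{0})
    (hEmb : ∀ (Z : Scheme.{0}) [IsIntegral Z] [IsNoetherian Z], Scheme.IsRegular Z →
      Scheme.IsExcellent Z → ∀ (X : Set Z), IsClosed X → X ≠ Set.univ → topologicalKrullDim X ≤ 2 →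
        ∃ (Z' : Scheme.{0}) (π : Z' ⟶ Z), IsProper π ∧ Function.Surjective π.base ∧
          (∃ U : Z.Opens, (U : Set Z) = Xᶜ ∧ IsIso (π ∣_ U)) ∧
          IsStrictNormalCrossingsDivisor Z' (π.base ⁻¹' X))
    {k K : Type} [Field k] [Field K] [Algebra k K]
    (O : ValuationSubring K)
    (hChains : ∀ (O₁ : ValuationSubring K) (hO : O ≤ O₁), O₁ ≠ O → O₁ ≠ ⊤ →
      ∀ (A : Subalgebra k K) (hA : A.toSubring ≤ O.toSubring), A.FG → IsFractionRing A K →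
      IsRegularLocalRing
        (Localization.AtPrime ((maximalIdeal O).comap (Subring.inclusion hA)) ⧸
          ((maximalIdeal O₁).comap (Subring.inclusion (hA.trans hO))).map
            (algebraMap A.toSubring (Localization.AtPrime ((maximalIdeal O).comap (Subring.inclusion hA))))) →
      ∀ (W : Finset K), (∀ w ∈ W, w ∈ A ∧ O₁.valuation w = 1) →
      ∃ (n : ℕ) (Sq : ℕ → Subring (ResidueField O₁)) (hSloc : ∀ i, IsLocalRing (Sq i)) (s : ℕ → ℕ)
        (zb : (i : ℕ) → Fin (s i + 1) → ResidueField O₁) (hzbS : ∀ i j, zb i j ∈ Sq i),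
        ((residue O₁).comp (Subring.inclusion ((locAtCentre_le hA).trans hO))).range = Sq 0 ∧
        (∀ i, i < n → (haveI := hSloc i; IsRsopPart (fun j : Fin (s i + 1) => (⟨zb i j, hzbS i j⟩ : Sq i)))) ∧
        (∀ i, i < n → (residueValuationSubring O O₁ hO).valuation (zb i 0) < 1) ∧
        (∀ i, i < n → ∀ l : Fin (s i),
          (residueValuationSubring O O₁ hO).valuation (zb i l.succ) ≤ (residueValuationSubring O O₁ hO).valuation (zb i 0)) ∧
        (∀ i, i < n → Sq (i + 1) =
          locAtCentre (Subring.closure ((Sq i : Set (ResidueField O₁)) ∪ Set.range fun l : Fin (s i) => zb i l.succ / zb i 0))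
            (residueValuationSubring O O₁ hO)) ∧
        ∃ (t : ℕ) (xb : Fin t → ResidueField O₁), (∀ i, xb i ∈ Sq n) ∧
          (∀ i, (residueValuationSubring O O₁ hO).valuation (xb i) < 1) ∧ (∀ i, xb i ≠ 0) ∧
          (∀ f ∈ Sq n, (residueValuationSubring O O₁ hO).valuation f < 1 →
            ∃ r : Fin t → ResidueField O₁, (∀ i, r i ∈ Sq n) ∧ f = ∑ i, r i * xb i) ∧
          IsRegularLocalRing (Sq n) ∧ ringKrullDim (Sq n) = (t : WithBot ℕ∞) ∧
          (∀ w : ResidueField O₁, ((∃ w' ∈ W, ∃ hw : w' ∈ O₁, residue O₁ ⟨w', hw⟩ = w) ∨ ∃ i < n, w = zb i 0) →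
            ∃ (ub : ResidueField O₁) (δ : Fin t → ℕ), ub ∈ Sq n ∧
              (residueValuationSubring O O₁ hO).valuation ub = 1 ∧ w = ub * ∏ i, xb i ^ δ i))
    (hRankOne : ¬ (∃ O₁ : ValuationSubring K, O ≤ O₁ ∧ O₁ ≠ O ∧ O₁ ≠ ⊤) →
      ∀ (A : Subalgebra k K), A.toSubring ≤ O.toSubring → A.FG → IsFractionRing A K →
      ringKrullDim A ≤ (4 : WithBot ℕ∞) →
      ∀ Z : Finset K, (∀ z ∈ Z, z ∈ A) →
      ∃ (A' : Subalgebra k K), A'.toSubring ≤ O.toSubring ∧ A ≤ A' ∧ A'.FG ∧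
      ∃ (_ : IsRegularLocalRing (locAtCentre A'.toSubring O)) (e : ℕ) (a : Fin e → ↥(locAtCentre A'.toSubring O)),
        Ideal.span (Set.range a) = IsLocalRing.maximalIdeal ↥(locAtCentre A'.toSubring O) ∧
        ringKrullDim ↥(locAtCentre A'.toSubring O) = (e : WithBot ℕ∞) ∧
        ∀ z ∈ Z, z ≠ 0 → ∃ (v : ↥(locAtCentre A'.toSubring O)) (μ : Fin e → ℕ), IsUnit v ∧
          z = (v : K) * ∏ i, ((a i : ↥(locAtCentre A'.toSubring O)) : K) ^ (μ i))
    (A : Subalgebra k K) (hAO : A.toSubring ≤ O.toSubring) (hAfg : A.FG) (hfrac : IsFractionRing A K)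
    (hdimA : ringKrullDim A ≤ (4 : WithBot ℕ∞)) (Z : Finset K) (hZ : ∀ z ∈ Z, z ∈ A) :
    ∃ (A' : Subalgebra k K), A'.toSubring ≤ O.toSubring ∧ A ≤ A' ∧ A'.FG ∧
      ∃ (_ : IsRegularLocalRing (locAtCentre A'.toSubring O)) (e : ℕ) (a : Fin e → ↥(locAtCentre A'.toSubring O)),
        Ideal.span (Set.range a) = IsLocalRing.maximalIdeal ↥(locAtCentre A'.toSubring O) ∧
        ringKrullDim ↥(locAtCentre A'.toSubring O) = (e : WithBot ℕ∞) ∧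
        ∀ z ∈ Z, z ≠ 0 → ∃ (v : ↥(locAtCentre A'.toSubring O)) (μ : Fin e → ℕ), IsUnit v ∧
          z = (v : K) * ∏ i, ((a i : ↥(locAtCentre A'.toSubring O)) : K) ^ (μ i) := by
  classical
  by_cases hR1 : ∃ O₁ : ValuationSubring K, O ≤ O₁ ∧ O₁ ≠ O ∧ O₁ ≠ ⊤
  swap
  · exact hRankOne hR1 A hAO hAfg hfrac hdimA Z hZ
  obtain ⟨O₁, hO, hne, hO₁⟩ := hR1
  haveI := hfrac
  set Ō := residueValuationSubring O O₁ hO with hŌdef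
  -- (S1)–(S4)
  obtain ⟨A₅, hA₅O, hAA₅, hA₅fg, hregQ₅, hregQ₅', Y, hIY, hYcard, c, γ, hcz⟩ :=
    preChain_normalForm hCP hEmb O O₁ hO hne hO₁ A hAO hAfg hfrac hdimA Z hZ
  have hA₅O₁ : A₅.toSubring ≤ O₁.toSubring := hA₅O.trans hO
  haveI hfrac₅ : IsFractionRing A₅.toSubring K := isFractionRing_subalgebra_of_le A A₅ hAA₅
  -- the coefficients to be monomialised on the residue side
  let Z' : Finset K := Z.filter (fun z => z ≠ 0)
  let W : Finset K := Z'.image (fun z => ((c z : A₅.toSubring) : K))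
  have hW : ∀ w ∈ W, w ∈ A₅ ∧ O₁.valuation w = 1 := by
    intro w hw
    obtain ⟨z, hz, rfl⟩ := Finset.mem_image.mp hw
    obtain ⟨hzZ, hz0⟩ := Finset.mem_filter.mp hz
    exact ⟨(c z).2, (hcz z hzZ hz0).1⟩
  -- (S5) the residue-side chain and its transport
  obtain ⟨n, Sq, hSloc, s, zb, hzbS, hS0, hrsop, hzb₀, hmin, hstep, t, xb, hxbS, hxb1, hxb0, hgen, hregS, hdimS, hmono⟩ :=
    hChains O₁ hO hne hO₁ A₅ hA₅O hA₅fg (isFractionRing_of_le hAA₅ hfrac) hregQ₅' W hW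
  obtain ⟨An, hAnO, hA₅An, hAnfg, hαn, D, hDA, hD1, ⟨hDO₁, uD, huD, hDres⟩, Yn, hYncard, hYnmem, hIYn, hSn⟩ :=
    chainTransport_of_isRsopPart O O₁ hO A₅ hA₅O hA₅fg Y hIY Sq hSloc hS0 s zb hzbS n hrsop hzb₀ hmin hstep
  have hAnO₁ : An.toSubring ≤ O₁.toSubring := hAnO.trans hO
  haveI hfracn : IsFractionRing An.toSubring K := isFractionRing_subalgebra_of_le A An (hAA₅.trans hA₅An)
  haveI := hSloc n
  have hD0 : D ≠ 0 := ne_zero_of_valuation_eq_one hD1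
  -- the residue ring of `An` is `Sq n`: regular of dimension `t`
  obtain ⟨θ, hθ⟩ := exists_centreResidueLift O O₁ hO An hAnO
  obtain ⟨e₁⟩ := nonempty_quotCentre_ringEquiv_range O O₁ hO An hAnO θ hθ
  have hθrange : θ.range = Sq n := by
    rw [range_centreResidueLift_eq_range_residue_locAtCentre O O₁ hO An hAnO θ hθ, hSn]
  let eQ := e₁.trans (RingEquiv.subringCongr hθrange)
  haveI : IsRegularLocalRing (Sq n) := hregS
  have hregQn : IsRegularLocalRing
      (Localization.AtPrime ((maximalIdeal O).comap (Subring.inclusion hAnO)) ⧸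
        ((maximalIdeal O₁).comap (Subring.inclusion (hAnO.trans hO))).map
          (algebraMap An.toSubring (Localization.AtPrime ((maximalIdeal O).comap (Subring.inclusion hAnO))))) :=
    IsRegularLocalRing.of_ringEquiv (R := Sq n) eQ.symm
  have hdimt : ringKrullDim
      (Localization.AtPrime ((maximalIdeal O).comap (Subring.inclusion hAnO)) ⧸
        ((maximalIdeal O₁).comap (Subring.inclusion (hAnO.trans hO))).map
          (algebraMap An.toSubring (Localization.AtPrime ((maximalIdeal O).comap (Subring.inclusion hAnO))))) = t := by
    rw [ringKrullDim_eq_of_ringEquiv eQ]; exact hdimS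
  -- `#Yn ≤ dim (An)_𝔭`
  have hYncard' : (Yn.card : WithBot ℕ∞) ≤
      ringKrullDim (Localization.AtPrime ((maximalIdeal O₁).comap (Subring.inclusion hAnO₁))) := by
    have e5 : Localization.AtPrime ((maximalIdeal O₁).comap (Subring.inclusion hA₅O₁)) ≃+* locAtCentre A₅.toSubring O₁ :=
      (locAtCentreEquiv hA₅O₁).toRingEquiv
    have en : Localization.AtPrime ((maximalIdeal O₁).comap (Subring.inclusion hAnO₁)) ≃+* locAtCentre An.toSubring O₁ :=
      (locAtCentreEquiv hAnO₁).toRingEquiv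
    rw [ringKrullDim_eq_of_ringEquiv en, hαn, ← ringKrullDim_eq_of_ringEquiv e5, hYncard]
    exact hYcard
  -- every `y / D`, `y ∈ Y`, is an element of `Yn`
  have hYhit : ∀ y ∈ Y, ∃ yn ∈ Yn, ((yn : An.toSubring) : K) = ((y : A₅.toSubring) : K) / D :=
    exists_mem_eq_of_card_eq Y Yn (fun y : A₅.toSubring => (y : K) / D) (fun yn : An.toSubring => (yn : K))
      (fun a _ a' _ h => Subtype.ext (by simpa [div_left_inj' hD0] using h)) Subtype.val_injective
      (fun yn hyn => (hYnmem yn).mp hyn) hYncard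
  choose ynOf hynOf hynOfval using hYhit
  -- the new coefficients and exponents
  let N : K → ℕ := fun z => ∑ y ∈ Y, γ z y
  have hcnmem : ∀ z, ((c z : A₅.toSubring) : K) * D ^ N z ∈ An := fun z =>
    An.mul_mem (hA₅An (c z).2) (An.pow_mem hDA _)
  let cn : K → An.toSubring := fun z => ⟨_, hcnmem z⟩
  let γn : K → An.toSubring → ℕ := fun z yn => ∑ y ∈ Y.filter (fun y => ((y : A₅.toSubring) : K) / D = (yn : K)), γ z y
  have hzn : ∀ z ∈ Z', z = ((cn z : An.toSubring) : K) * ∏ yn ∈ Yn, ((yn : An.toSubring) : K) ^ (γn z yn) := by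
    intro z hz
    obtain ⟨hzZ, hz0⟩ := Finset.mem_filter.mp hz
    obtain ⟨-, hzeq⟩ := hcz z hzZ hz0
    -- regroup `∏_{y ∈ Y} (y/D)^γ` over `Yn`
    have hprod : ∏ yn ∈ Yn, ((yn : An.toSubring) : K) ^ (γn z yn) = ∏ y ∈ Y, (((y : A₅.toSubring) : K) / D) ^ (γ z y) := by
      have himg : Yn = Y.attach.image (fun y => ynOf y.1 y.2) := by
        ext yn
        constructor
        · intro hyn
          obtain ⟨y, hy, hyy⟩ := (hYnmem yn).mp hyn
          refine Finset.mem_image.mpr ⟨⟨y, hy⟩, Finset.mem_attach _ _, Subtype.ext ?_⟩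
          rw [hynOfval y hy, hyy]
        · intro hyn
          obtain ⟨y, -, rfl⟩ := Finset.mem_image.mp hyn
          exact hynOf y.1 y.2
      rw [himg, Finset.prod_image]
      · rw [← Finset.prod_attach Y]
        refine Finset.prod_congr rfl fun y _ => ?_
        rw [hynOfval y.1 y.2]
        congr 1
        -- `γn z (ynOf y) = γ z y`: the fibre of `y/D` over `Y` is `{y}`
        simp only [γn]
        rw [hynOfval y.1 y.2]
        have : Y.filter (fun y' => ((y' : A₅.toSubring) : K) / D = ((y.1 : A₅.toSubring) : K) / D) = {y.1} := by
          ext y'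
          simp only [Finset.mem_filter, Finset.mem_singleton, div_left_inj' hD0]
          constructor
          · rintro ⟨-, h⟩; exact Subtype.ext h
          · rintro rfl; exact ⟨y.2, rfl⟩
        rw [this, Finset.sum_singleton]
      · intro y _ y' _ h
        have := congrArg (fun x : An.toSubring => (x : K)) h
        simp only [hynOfval] at this
        rw [div_left_inj' hD0] at this
        exact Subtype.ext (Subtype.ext this)
    rw [hprod]
    change z = ((c z : A₅.toSubring) : K) * D ^ (∑ y ∈ Y, γ z y) * ∏ y ∈ Y, (((y : A₅.toSubring) : K) / D) ^ (γ z y)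
    conv_lhs => rw [hzeq]
    simp only [div_pow]
    rw [Finset.prod_div_distrib, Finset.prod_pow_eq_pow_sum]
    have : D ^ N z ≠ 0 := pow_ne_zero _ hD0
    field_simp
  -- the residues of the new coefficients are unit × monomial in `x̄`
  have hcres : ∀ z ∈ Z', ∃ (ub : ResidueField O₁) (δ : Fin t → ℕ),
      ub ∈ ((residue O₁).comp (Subring.inclusion ((locAtCentre_le hAnO).trans hO))).range ∧
      Ō.valuation ub = 1 ∧
      residue O₁ ⟨((cn z : An.toSubring) : K), hO (hAnO (cn z).2)⟩ = ub * ∏ i, xb i ^ δ i := by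
    intro z hz
    have hcw : ((c z : A₅.toSubring) : K) ∈ W := Finset.mem_image.mpr ⟨z, hz, rfl⟩
    have hcO₁ : ((c z : A₅.toSubring) : K) ∈ O₁ := hA₅O₁ (c z).2
    -- the factors: residue of `c z`, residues of the `z̄₀⁽ⁱ⁾`, the unit `uD`
    have hDform : ∃ (ub : ResidueField O₁) (δ : Fin t → ℕ), ub ∈ Sq n ∧ Ō.valuation ub = 1 ∧
        residue O₁ ⟨D, hDO₁⟩ = ub * ∏ l, xb l ^ δ l := by
      obtain ⟨u₀, δ₀, hu₀S, hu₀, h₀⟩ := isMonomialForm_prod Ō (Sq n) xb (Finset.range n) (fun i => zb i 0)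
        (fun i hi => hmono _ (Or.inr ⟨i, Finset.mem_range.mp hi, rfl⟩))
      have huDval : Ō.valuation ((uD : Sq n) : ResidueField O₁) = 1 := by
        -- `uD` is a unit of `Sq n ⊆ Ō`-units? its value: a unit of `Sq n` has a `Sq n`-inverse, both in `Ō`
        have hSŌ : Sq n ≤ Ō.toSubring := by
          rw [← hSn]; rintro _ ⟨x, rfl⟩
          exact (residue_mem_residueValuationSubring_iff O O₁ hO _).mpr (locAtCentre_le hAnO x.2)
        obtain ⟨v, hv⟩ := huD.exists_right_inv
        have h1 : Ō.valuation ((uD : ResidueField O₁)) * Ō.valuation ((v : Sq n) : ResidueField O₁) = 1 := by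
          rw [← map_mul, ← Subring.coe_mul, hv, Subring.coe_one, map_one]
        have hle1 : Ō.valuation ((uD : Sq n) : ResidueField O₁) ≤ 1 := (Ō.valuation_le_one_iff _).mpr (hSŌ uD.2)
        have hle2 : Ō.valuation ((v : Sq n) : ResidueField O₁) ≤ 1 := (Ō.valuation_le_one_iff _).mpr (hSŌ v.2)
        by_contra hne1
        have hlt : Ō.valuation ((uD : Sq n) : ResidueField O₁) < 1 := lt_of_le_of_ne hle1 hne1
        have : Ō.valuation ((uD : Sq n) : ResidueField O₁) * Ō.valuation ((v : Sq n) : ResidueField O₁) < 1 :=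
          calc _ ≤ Ō.valuation ((uD : Sq n) : ResidueField O₁) * 1 := by gcongr
            _ = _ := mul_one _
            _ < 1 := hlt
        rw [h1] at this; exact lt_irrefl _ this
      refine ⟨u₀ * uD, δ₀, (Sq n).mul_mem hu₀S uD.2, by rw [map_mul, hu₀, huDval, one_mul], ?_⟩
      rw [hDres, h₀]; ring
    obtain ⟨u₁, δ₁, hu₁S, hu₁, h₁⟩ := hmono _ (Or.inl ⟨_, hcw, hcO₁, rfl⟩)
    obtain ⟨u₂, δ₂, hu₂S, hu₂, h₂⟩ := hDform
    refine ⟨u₁ * u₂ ^ N z, δ₁ + N z • δ₂, ?_, by rw [map_mul, map_pow, hu₁, hu₂, one_pow, one_mul], ?_⟩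
    · rw [hSn]; exact (Sq n).mul_mem hu₁S ((Sq n).pow_mem hu₂S _)
    · have : (⟨((cn z : An.toSubring) : K), hO (hAnO (cn z).2)⟩ : O₁) = ⟨((c z : A₅.toSubring) : K), hcO₁⟩ * ⟨D, hDO₁⟩ ^ N z :=
        Subtype.ext rfl
      rw [this, map_mul, map_pow, h₁, h₂]
      have key : ∀ x, xb x ^ ((δ₁ + N z • δ₂) x) = xb x ^ δ₁ x * (xb x ^ δ₂ x) ^ N z := fun x => by
        simp only [Pi.add_apply, Pi.smul_apply, smul_eq_mul]
        rw [pow_add, ← pow_mul, mul_comm (δ₂ x)]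
      simp only [key, Finset.prod_mul_distrib, Finset.prod_pow, mul_pow]
      ring
  -- (S6)
  have hxbρ : ∀ i, xb i ∈ ((residue O₁).comp (Subring.inclusion ((locAtCentre_le hAnO).trans hO))).range := fun i => by
    rw [hSn]; exact hxbS i
  have hgen' : ∀ f ∈ ((residue O₁).comp (Subring.inclusion ((locAtCentre_le hAnO).trans hO))).range, Ō.valuation f < 1 →
      ∃ r : Fin t → ResidueField O₁, (∀ i, r i ∈ ((residue O₁).comp (Subring.inclusion ((locAtCentre_le hAnO).trans hO))).range) ∧
        f = ∑ i, r i * xb i := by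
    intro f hf hfv
    rw [hSn] at hf
    obtain ⟨r, hr, hsum⟩ := hgen f hf hfv
    exact ⟨r, fun i => by rw [hSn]; exact hr i, hsum⟩
  obtain ⟨A', hA'O, hAnA', hA'fg, hreg', e', a', ha', hdim', hmono'⟩ :=
    absorb_of_residue_monomial O O₁ hO An hAnO hAnfg hfracn Yn hIYn hYncard' hregQn t hdimt xb hxbρ hxb1 hxb0 hgen' Z' cn γn hzn hcres
  refine ⟨A', hA'O, (hAA₅.trans hA₅An).trans hAnA', hA'fg, hreg', e', a', ha', hdim', fun z hzZ hz0 => ?_⟩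
  exact hmono' z (Finset.mem_filter.mpr ⟨hzZ, hz0⟩) hz0

end Summit.ResolutionOfSingularities.ResolutionOfSingularities.Theorems.RadicialJung.CleanModels

end
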